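import Summits.CriticalPhenomena.PercolationContinuityZ3.Theorems.PercAnnulusCrossingSetToSetHighDim
import Summits.CriticalPhenomena.PercolationContinuityZ3.Theorems.PercAnnulusCrossingSetToSetQuasiMultClosed
import Summits.CriticalPhenomena.PercolationContinuityZ3.Theorems.PercAnnulusCrossingIICOfUniformCondConn
import Summits.CriticalPhenomena.PercolationContinuityZ3.Theorems.PercAnnulusCrossingSetToSetHighDimAspect
import Literature.Probability.Percolation.CriticalContinuityProofs
import Literature.Barriers.CriticalPhenomena.LaceExpansionEtaZeroXSpaceEventually
import HarnessLib

/-!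
# Above six dimensions the supercritical (A2)□ constants degenerate at `p_c` (lane RSW3, p1 gen 8)

builds on p205010 (kernel theorem, internal audit signed; external expert review pending) — NOT used in this file.

RSW3 lane (LANE 3 `prim-rsw3`), seat `prim-rsw3-p1` (gen 8).  Helper file (`--supports stmt-CriticalPhenomena-4575`); no definitions, no sorries.
The dictionary of `…SetToSetQuasiMultClosed` ((A2)□ with a fixed constant is a CLOSED condition in `p`, so (A2)□ at `p_c` ⟸ one constant on a
sequence `p_k → p_c`) read contrapositively against lead gen 13's `…SetToSetHighDim` ((A2)□ FAILS at `p_c(ℤ^d)`, `d > 6`, under (t-c) with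
`η = 0`; `d ≥ 11` granted the named fact `Hara2008_etaZeroXSpace`):

* **`eventually_not_setToSetQuasiMultAt_nhds_criticalProbI`** — `6 < d`, `TwoPointBoundedRatio d`, `ϰ > 0` ⇒ `∀ᶠ p in 𝓝 p_c, ¬ (A2)□(p, ϰ)`: NO
  constant works in any neighbourhood of `p_c` — although (A2)□ holds at EACH `p > p_c` in every `d ≥ 3` (lead gen 12, `…SupercriticalSetToSetZd`),
  the optimal constants `ϰ*(p) → 0` as `p → p_c` above six dimensions;
* `exists_supercritical_not_setToSetQuasiMultAt` — in particular `∀ q > p_c ∃ p ∈ (p_c, q), ¬ (A2)□(p, ϰ)`;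
* `…_of_hara` versions for `d ≥ 11`;
* (appended) **`not_uniform_condConn_of_twoPointBoundedRatio`** / `…_of_hara` — the conditional-connection FLOOR hypothesis of lead gen 12's bridge
  `kestenIICExistsAt_criticalProbI_of_uniform_condConn` ('c₀·P_p(A∩B) ≤ P_p(C)` uniformly in p ∈ (p_c,q), m ≥ M₀, admissible (Z,X,Y)') is FALSE
  above six dimensions, for every c₀ > 0, q > p_c, M₀.
* (appended) ASPECT FORMS (lead gen 13's `…SetToSetHighDimAspect`: (A2)□ fails at `p_c` at EVERY aspect `(s,L)`, `s ≥ 1`, for `8 < d` under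
  (t-c) `η = 0`): `eventually_not_setToSetQuasiMultAspectAt_nhds_criticalProbI`, `exists_supercritical_not_setToSetQuasiMultAspectAt`,
  `not_exists_uniform_supercritical_setToSetQuasiMultAspectAt` (+ `_of_hara`): no aspect-`(s,L)` constant survives near `p_c` in `d > 8` (`d ≥ 11` named).
* (appended) UNCONDITIONAL LARGE-`d` FORMS via the catalogue's kernel theorem `twoPointBoundedRatio_eventually` (`∃ d₀ > 6 ∀ d ≥ d₀`, (t-c) with
  `η = 0`, no named fact): `exists_dim_eventually_not_setToSetQuasiMultAt_nhds_criticalProbI`, `exists_dim_not_exists_uniform_supercritical_setToSetQuasiMultAt`,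
  `exists_dim_eventually_not_setToSetQuasiMultAspectAt_nhds_criticalProbI`, `exists_dim_not_uniform_condConn` — for all sufficiently large `d`, with NO hypothesis.
So the LANE-4 bridge 'uniform supercritical (A2)□ constants ⇒ IIC at p_c' (`kestenIICExistsAt_criticalProbI_of_supercritical_uniform`) has a
hypothesis that is PROVABLY FALSE above six dimensions (where Kesten's IIC nevertheless exists by the lace expansion): the bridge is a low-dimensional route.
References: D. Basu, A. Sapozhnikov, ECP 22 (2017) no. 26, §1 (A2); M. Heydenreich, R. van der Hofstad (2017), Thm 11.4; T. Hara, Ann. Probab. 36 (2008).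
-/

noncomputable section

namespace Summit.CriticalPhenomena.PercolationContinuityZ3.Theorems.Crossing

open MeasureTheory Filter Topology Literature.Probability.Percolation Literature.Probability.LatticeModels
open Literature.Probability.Percolation.DCT16 Literature.Barriers.CriticalPhenomena

variable {d : ℕ}

/-- **Above six dimensions no (A2)□ constant survives near `p_c`**: `6 < d`, (t-c) with `η = 0`, `ϰ > 0` ⇒ `∀ᶠ p in 𝓝 p_c(ℤ^d), ¬ SetToSetQuasiMultAt d p ϰ`
(else (A2)□ would hold frequently near `p_c`, hence at `p_c` by closedness — contradicting `…SetToSetHighDim`).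
[cite: BasuSapozhnikov2017ECP, §1 assumption (A2)] [cite: HeydenreichVanDerHofstad2017, Thm. 11.4] -/
theorem eventually_not_setToSetQuasiMultAt_nhds_criticalProbI (hd : 6 < d) (hτ : TwoPointBoundedRatio d) {ϰ : ℝ} (hϰ : 0 < ϰ) :
    ∀ᶠ p : unitInterval in 𝓝 (criticalProbI d), ¬ SetToSetQuasiMultAt d p ϰ := by
  by_contra h
  rw [Filter.not_eventually] at h
  exact not_setToSetQuasiMultAt_criticalProbI_of_twoPointBoundedRatio hd hτ hϰ
    (setToSetQuasiMultAt_of_frequently (by simpa only [not_not] using h))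

/-- **In every interval `(p_c, q)` some `p` violates (A2)□ with constant `ϰ`** (`6 < d`, (t-c) with `η = 0`, `ϰ > 0`): the supercritical
constants degenerate at `p_c`. [cite: BasuSapozhnikov2017ECP, §1 assumption (A2)] [cite: HeydenreichVanDerHofstad2017, Thm. 11.4] -/
theorem exists_supercritical_not_setToSetQuasiMultAt (hd : 6 < d) (hτ : TwoPointBoundedRatio d) {ϰ : ℝ} (hϰ : 0 < ϰ)
    {q : unitInterval} (hq : criticalProbI d < q) :
    ∃ p : unitInterval, criticalProbI d < p ∧ p < q ∧ ¬ SetToSetQuasiMultAt d p ϰ := by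
  by_contra h
  push Not at h
  exact not_setToSetQuasiMultAt_criticalProbI_of_twoPointBoundedRatio hd hτ hϰ
    (setToSetQuasiMultAt_criticalProbI_of_supercritical hq h)

/-- **No uniform supercritical (A2)□ constant above six dimensions**: `6 < d`, (t-c) with `η = 0` ⇒ there is no `ϰ > 0` with
`SetToSetQuasiMultAt d p ϰ` for all `p > p_c` (`d ≥ 2` automatic). [cite: BasuSapozhnikov2017ECP, §1 assumption (A2)] -/
theorem not_exists_uniform_supercritical_setToSetQuasiMultAt (hd : 6 < d) (hτ : TwoPointBoundedRatio d) :
    ¬ ∃ ϰ : ℝ, 0 < ϰ ∧ ∀ p : unitInterval, criticalProbI d < p → SetToSetQuasiMultAt d p ϰ := by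
  rintro ⟨ϰ, hϰ, h⟩
  exact not_setToSetQuasiMultAt_criticalProbI_of_twoPointBoundedRatio hd hτ hϰ
    (setToSetQuasiMultAt_criticalProbI_of_supercritical' (by omega) h)

/-- `d ≥ 11` version of `eventually_not_setToSetQuasiMultAt_nhds_criticalProbI`, granted the named fact `Hara2008_etaZeroXSpace`.
[cite: HeydenreichVanDerHofstad2017, Thm. 11.4] -/
theorem eventually_not_setToSetQuasiMultAt_nhds_criticalProbI_of_hara (hH : Hara2008_etaZeroXSpace) (hd : 11 ≤ d) {ϰ : ℝ}
    (hϰ : 0 < ϰ) : ∀ᶠ p : unitInterval in 𝓝 (criticalProbI d), ¬ SetToSetQuasiMultAt d p ϰ :=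
  eventually_not_setToSetQuasiMultAt_nhds_criticalProbI (by omega) (hH.twoPointBoundedRatio hd) hϰ

/-- `d ≥ 11` version of `not_exists_uniform_supercritical_setToSetQuasiMultAt`, granted `Hara2008_etaZeroXSpace`: the hypothesis of the
LANE-4 bridge `kestenIICExistsAt_criticalProbI_of_supercritical_uniform` is false in every `d ≥ 11`. [cite: HeydenreichVanDerHofstad2017, Thm. 11.4] -/
theorem not_exists_uniform_supercritical_setToSetQuasiMultAt_of_hara (hH : Hara2008_etaZeroXSpace) (hd : 11 ≤ d) :
    ¬ ∃ ϰ : ℝ, 0 < ϰ ∧ ∀ p : unitInterval, criticalProbI d < p → SetToSetQuasiMultAt d p ϰ :=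
  not_exists_uniform_supercritical_setToSetQuasiMultAt (by omega) (hH.twoPointBoundedRatio hd)

/-! ## Appendix: the conditional-connection floor of the bridge fails above six dimensions -/

/-- **No uniform supercritical conditional-connection floor above six dimensions.**  If `6 < d` and (t-c) holds with `η = 0`, then for every
`q > p_c`, `c₀ > 0` and `M₀` the hypothesis of lead gen 12's bridge `kestenIICExistsAt_criticalProbI_of_uniform_condConn` — `c₀ · P_p(A ∩ B) ≤ P_p(C)`
for all `p ∈ (p_c, q)`, all `m ≥ M₀` and all admissible `(Z, X, Y)` at aspect `(2,4)` — FAILS (it would give (A2)□ at `p_c`, `…IICOfUniformCondConn`,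
against `…SetToSetHighDim`). [cite: BasuSapozhnikov2017ECP, §1 assumption (A2)] [cite: HeydenreichVanDerHofstad2017, Thm. 11.4] -/
theorem not_uniform_condConn_of_twoPointBoundedRatio (hd : 6 < d) (hτ : TwoPointBoundedRatio d) {q : unitInterval}
    (hq : criticalProbI d < q) {c₀ : ℝ} (hc₀ : 0 < c₀) (M₀ : ℕ) :
    ¬ (∀ p : unitInterval, criticalProbI d < p → p < q → ∀ m : ℕ, M₀ ≤ m →
      ∀ Z : Finset (Site d), box d (4 * m) \ box d (m - 1) ⊆ Z →
      ∀ X : Finset (Site d), X ⊆ Z ∩ box d m → ∀ Y : Finset (Site d), Y ⊆ Z \ box d (4 * m) →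
        c₀ * (bondPercolation (zdGraph d) p).real
            ({ω | ∃ x ∈ X, ∃ s ∈ innerBoundary (zdGraph d) (box d (2 * m)), ω ∈ openConnIn (↑Z : Set (Site d)) x s} ∩
              {ω | ∃ y ∈ Y, ∃ s ∈ innerBoundary (zdGraph d) (box d (2 * m)), ω ∈ openConnIn (↑Z : Set (Site d)) y s}) ≤
          (bondPercolation (zdGraph d) p).real {ω | ∃ x ∈ X, ∃ y ∈ Y, ω ∈ openConnIn (↑Z : Set (Site d)) x y}) := by
  intro h
  obtain ⟨ϰ, hϰ, hA2⟩ := exists_setToSetQuasiMultAt_criticalProbI_of_uniform_condConn (by omega) hq hc₀ h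
  exact not_setToSetQuasiMultAt_criticalProbI_of_twoPointBoundedRatio hd hτ hϰ hA2

/-- `d ≥ 11` version of `not_uniform_condConn_of_twoPointBoundedRatio`, granted the named fact `Hara2008_etaZeroXSpace`.
[cite: HeydenreichVanDerHofstad2017, Thm. 11.4] -/
theorem not_uniform_condConn_of_hara (hH : Hara2008_etaZeroXSpace) (hd : 11 ≤ d) {q : unitInterval}
    (hq : criticalProbI d < q) {c₀ : ℝ} (hc₀ : 0 < c₀) (M₀ : ℕ) :
    ¬ (∀ p : unitInterval, criticalProbI d < p → p < q → ∀ m : ℕ, M₀ ≤ m →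
      ∀ Z : Finset (Site d), box d (4 * m) \ box d (m - 1) ⊆ Z →
      ∀ X : Finset (Site d), X ⊆ Z ∩ box d m → ∀ Y : Finset (Site d), Y ⊆ Z \ box d (4 * m) →
        c₀ * (bondPercolation (zdGraph d) p).real
            ({ω | ∃ x ∈ X, ∃ s ∈ innerBoundary (zdGraph d) (box d (2 * m)), ω ∈ openConnIn (↑Z : Set (Site d)) x s} ∩
              {ω | ∃ y ∈ Y, ∃ s ∈ innerBoundary (zdGraph d) (box d (2 * m)), ω ∈ openConnIn (↑Z : Set (Site d)) y s}) ≤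
          (bondPercolation (zdGraph d) p).real {ω | ∃ x ∈ X, ∃ y ∈ Y, ω ∈ openConnIn (↑Z : Set (Site d)) x y}) :=
  not_uniform_condConn_of_twoPointBoundedRatio (by omega) (hH.twoPointBoundedRatio hd) hq hc₀ M₀

/-! ## Appendix 2: every aspect `(s,L)` (`8 < d`) -/

/-- **Above eight dimensions no aspect-`(s,L)` (A2)□ constant survives near `p_c`**: `8 < d`, (t-c) with `η = 0`, `1 ≤ s`, `ϰ > 0` ⇒
`∀ᶠ p in 𝓝 p_c(ℤ^d), ¬ SetToSetQuasiMultAspectAt d p s L ϰ` (closedness of `…SetToSetQuasiMultClosed` against `…SetToSetHighDimAspect`).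
[cite: BasuSapozhnikov2017ECP, §1 assumption (A2)] [cite: HeydenreichVanDerHofstad2017, Thm. 11.4] -/
theorem eventually_not_setToSetQuasiMultAspectAt_nhds_criticalProbI (hd : 8 < d) (hτ : TwoPointBoundedRatio d) {s : ℕ} (hs : 1 ≤ s)
    (L : ℕ) {ϰ : ℝ} (hϰ : 0 < ϰ) :
    ∀ᶠ p : unitInterval in 𝓝 (criticalProbI d), ¬ SetToSetQuasiMultAspectAt d p s L ϰ := by
  by_contra h
  rw [Filter.not_eventually] at h
  have hfreq : ∃ᶠ p : unitInterval in 𝓝 (criticalProbI d), SetToSetQuasiMultAspectAt d p s L ϰ := by simpa only [not_not] using h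
  have hmem : criticalProbI d ∈ closure {q : unitInterval | SetToSetQuasiMultAspectAt d q s L ϰ} := mem_closure_iff_frequently.2 hfreq
  rw [(isClosed_setOf_setToSetQuasiMultAspectAt d s L ϰ).closure_eq] at hmem
  exact not_setToSetQuasiMultAspectAt_criticalProbI_of_twoPointBoundedRatio hd hτ hs L hϰ hmem

/-- In every interval `(p_c, q)` some `p` violates aspect-`(s,L)` (A2)□ with constant `ϰ` (`8 < d`, (t-c) `η = 0`, `1 ≤ s`, `ϰ > 0`).
[cite: BasuSapozhnikov2017ECP, §1 assumption (A2)] -/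
theorem exists_supercritical_not_setToSetQuasiMultAspectAt (hd : 8 < d) (hτ : TwoPointBoundedRatio d) {s : ℕ} (hs : 1 ≤ s) (L : ℕ)
    {ϰ : ℝ} (hϰ : 0 < ϰ) {q : unitInterval} (hq : criticalProbI d < q) :
    ∃ p : unitInterval, criticalProbI d < p ∧ p < q ∧ ¬ SetToSetQuasiMultAspectAt d p s L ϰ := by
  by_contra h
  push Not at h
  exact not_setToSetQuasiMultAspectAt_criticalProbI_of_twoPointBoundedRatio hd hτ hs L hϰ
    (setToSetQuasiMultAspectAt_criticalProbI_of_supercritical hq h)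

/-- **No uniform supercritical aspect-`(s,L)` (A2)□ constant above eight dimensions** (`8 < d`, (t-c) `η = 0`, `1 ≤ s`).
[cite: BasuSapozhnikov2017ECP, §1 assumption (A2)] -/
theorem not_exists_uniform_supercritical_setToSetQuasiMultAspectAt (hd : 8 < d) (hτ : TwoPointBoundedRatio d) {s : ℕ} (hs : 1 ≤ s)
    (L : ℕ) : ¬ ∃ ϰ : ℝ, 0 < ϰ ∧ ∀ p : unitInterval, criticalProbI d < p → SetToSetQuasiMultAspectAt d p s L ϰ := by
  rintro ⟨ϰ, hϰ, h⟩
  have hq : criticalProbI d < 1 := by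
    change (criticalProbI d : ℝ) < ((1 : unitInterval) : ℝ)
    rw [coe_criticalProbI]
    exact criticalProb_zd_lt_one (by omega)
  exact not_setToSetQuasiMultAspectAt_criticalProbI_of_twoPointBoundedRatio hd hτ hs L hϰ
    (setToSetQuasiMultAspectAt_criticalProbI_of_supercritical hq fun p hp _ => h p hp)

/-- `d ≥ 11` version of `eventually_not_setToSetQuasiMultAspectAt_nhds_criticalProbI`, granted `Hara2008_etaZeroXSpace`.
[cite: HeydenreichVanDerHofstad2017, Thm. 11.4] -/
theorem eventually_not_setToSetQuasiMultAspectAt_nhds_criticalProbI_of_hara (hH : Hara2008_etaZeroXSpace) (hd : 11 ≤ d) {s : ℕ}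
    (hs : 1 ≤ s) (L : ℕ) {ϰ : ℝ} (hϰ : 0 < ϰ) :
    ∀ᶠ p : unitInterval in 𝓝 (criticalProbI d), ¬ SetToSetQuasiMultAspectAt d p s L ϰ :=
  eventually_not_setToSetQuasiMultAspectAt_nhds_criticalProbI (by omega) (hH.twoPointBoundedRatio hd) hs L hϰ

/-- `d ≥ 11` version of `not_exists_uniform_supercritical_setToSetQuasiMultAspectAt`, granted `Hara2008_etaZeroXSpace`: the aspect-general
LANE-4 hypotheses 'one constant ϰ on the whole supercritical phase' fail in every `d ≥ 11`. [cite: HeydenreichVanDerHofstad2017, Thm. 11.4] -/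
theorem not_exists_uniform_supercritical_setToSetQuasiMultAspectAt_of_hara (hH : Hara2008_etaZeroXSpace) (hd : 11 ≤ d) {s : ℕ}
    (hs : 1 ≤ s) (L : ℕ) : ¬ ∃ ϰ : ℝ, 0 < ϰ ∧ ∀ p : unitInterval, criticalProbI d < p → SetToSetQuasiMultAspectAt d p s L ϰ :=
  not_exists_uniform_supercritical_setToSetQuasiMultAspectAt (by omega) (hH.twoPointBoundedRatio hd) hs L

/-! ## Appendix 3: unconditional forms for all sufficiently large `d` -/

/-- **UNCONDITIONALLY, for all sufficiently large `d`: no (A2)□ constant survives near `p_c(ℤ^d)`** — `∃ d₀ ∀ d ≥ d₀ ∀ ϰ > 0, ∀ᶠ p in 𝓝 p_c, ¬(A2)□(p,ϰ)`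
(the catalogue's kernel theorem `twoPointBoundedRatio_eventually`, Hara 2008 / Hara–Slade for large `d`, no named fact).
[cite: HeydenreichVanDerHofstad2017, Thm. 11.4] [cite: BasuSapozhnikov2017ECP, §1 assumption (A2)] -/
theorem exists_dim_eventually_not_setToSetQuasiMultAt_nhds_criticalProbI :
    ∃ d₀ : ℕ, ∀ d : ℕ, d₀ ≤ d → ∀ ϰ : ℝ, 0 < ϰ → ∀ᶠ p : unitInterval in 𝓝 (criticalProbI d), ¬ SetToSetQuasiMultAt d p ϰ := by
  obtain ⟨d₀, hd₀, h⟩ := twoPointBoundedRatio_eventually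
  exact ⟨d₀, fun d hd ϰ hϰ => eventually_not_setToSetQuasiMultAt_nhds_criticalProbI (by omega) (h d hd) hϰ⟩

/-- **UNCONDITIONALLY, for all sufficiently large `d`: no uniform supercritical (A2)□ constant.** [cite: BasuSapozhnikov2017ECP, §1 assumption (A2)] -/
theorem exists_dim_not_exists_uniform_supercritical_setToSetQuasiMultAt :
    ∃ d₀ : ℕ, ∀ d : ℕ, d₀ ≤ d → ¬ ∃ ϰ : ℝ, 0 < ϰ ∧ ∀ p : unitInterval, criticalProbI d < p → SetToSetQuasiMultAt d p ϰ := by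
  obtain ⟨d₀, hd₀, h⟩ := twoPointBoundedRatio_eventually
  exact ⟨d₀, fun d hd => not_exists_uniform_supercritical_setToSetQuasiMultAt (by omega) (h d hd)⟩

/-- **UNCONDITIONALLY, for all sufficiently large `d`, at EVERY aspect `(s,L)`, `s ≥ 1`: no constant survives near `p_c`.**
[cite: BasuSapozhnikov2017ECP, §1 assumption (A2)] -/
theorem exists_dim_eventually_not_setToSetQuasiMultAspectAt_nhds_criticalProbI :
    ∃ d₀ : ℕ, ∀ d : ℕ, d₀ ≤ d → ∀ s : ℕ, 1 ≤ s → ∀ L : ℕ, ∀ ϰ : ℝ, 0 < ϰ →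
      ∀ᶠ p : unitInterval in 𝓝 (criticalProbI d), ¬ SetToSetQuasiMultAspectAt d p s L ϰ := by
  obtain ⟨d₀, hd₀, h⟩ := twoPointBoundedRatio_eventually
  refine ⟨max d₀ 9, fun d hd s hs L ϰ hϰ => ?_⟩
  have hd₀d : d₀ ≤ d := le_trans (le_max_left _ _) hd
  have h9 : 9 ≤ d := le_trans (le_max_right _ _) hd
  exact eventually_not_setToSetQuasiMultAspectAt_nhds_criticalProbI (by omega) (h d hd₀d) hs L hϰ

/-- **UNCONDITIONALLY, for all sufficiently large `d`: the conditional-connection floor of the bridge fails** (every `q > p_c`, `c₀ > 0`, `M₀`).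
[cite: BasuSapozhnikov2017ECP, §1 assumption (A2)] -/
theorem exists_dim_not_uniform_condConn :
    ∃ d₀ : ℕ, ∀ d : ℕ, d₀ ≤ d → ∀ q : unitInterval, criticalProbI d < q → ∀ c₀ : ℝ, 0 < c₀ → ∀ M₀ : ℕ,
    ¬ (∀ p : unitInterval, criticalProbI d < p → p < q → ∀ m : ℕ, M₀ ≤ m →
      ∀ Z : Finset (Site d), box d (4 * m) \ box d (m - 1) ⊆ Z →
      ∀ X : Finset (Site d), X ⊆ Z ∩ box d m → ∀ Y : Finset (Site d), Y ⊆ Z \ box d (4 * m) →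
        c₀ * (bondPercolation (zdGraph d) p).real
            ({ω | ∃ x ∈ X, ∃ s ∈ innerBoundary (zdGraph d) (box d (2 * m)), ω ∈ openConnIn (↑Z : Set (Site d)) x s} ∩
              {ω | ∃ y ∈ Y, ∃ s ∈ innerBoundary (zdGraph d) (box d (2 * m)), ω ∈ openConnIn (↑Z : Set (Site d)) y s}) ≤
          (bondPercolation (zdGraph d) p).real {ω | ∃ x ∈ X, ∃ y ∈ Y, ω ∈ openConnIn (↑Z : Set (Site d)) x y}) := by
  obtain ⟨d₀, hd₀, h⟩ := twoPointBoundedRatio_eventually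
  exact ⟨d₀, fun d hd q hq c₀ hc₀ M₀ => not_uniform_condConn_of_twoPointBoundedRatio (by omega) (h d hd) hq hc₀ M₀⟩

end Summit.CriticalPhenomena.PercolationContinuityZ3.Theorems.Crossing
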